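import Summits.CriticalPhenomena.Ising3DConformalLimit.Theorems.HyperoctahedralRPExistsScaleCovariantLimitFunnelDoublingIffAxisRate
import Summits.CriticalPhenomena.Ising3DConformalLimit.Theorems.HyperoctahedralRPExistsScaleCovariantLimitFoldedCurrentSqrtDoublingCore
import Summits.CriticalPhenomena.Ising3DConformalLimit.Theorems.HyperoctahedralRPExistsScaleCovariantLimitFoldedCurrentSqrtDoublingDenominator
import Summits.CriticalPhenomena.Ising3DConformalLimit.Theorems.HyperoctahedralRPExistsScaleCovariantLimitFoldedCurrentSqrtDoublingDescend
import Summits.CriticalPhenomena.Ising3DConformalLimit.Theorems.HyperoctahedralRPExistsScaleCovariantLimitFoldedCurrentSqrtDoublingHeadSum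
import Summits.CriticalPhenomena.Ising3DConformalLimit.Theorems.HyperoctahedralRPExistsScaleCovariantLimitFoldedCurrentHeavyScaleDoubling
import Literature.Probability.LatticeModels.CriticalAxisRatioRegularity
import HarnessLib

/-!
# Line `folded-current-repulsion`, engine F2 (= item 6150): √n-DOUBLING of the critical axis two-point function at EVERY scale

Lead `prover-line-stmt-CriticalPhenomena-1981-c15-0` (crux `ExistsScaleCovariantLimit`, stmt-CriticalPhenomena-1981), registered
sub-goal `sqrt_doubling`. Write `g(n) = ⟨σ₀σ_{ne₀}⟩_{β_c(3)} = criticalTwoPoint 3 (Pi.single 0 n)` (nearest-neighbour Ising model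
on `ℤ³`, plus state = free state at `β_c`). Item 6150 `TwoPointDoubling` — the open all-scale doubling `g(2n) ≥ κ g(n)`,
equivalently the log-free axial gradient bound of Aizenman–Duminil-Copin (Ann. Math. 2021, Remark 5.10) — is the engine F2 of this
line and the compactness half of the crux. This file proves the quantitative partial

  `sqrt_doubling : ∃ c > 0, ∀ n ≥ 1, g(2n) ≥ c · n^{-1/2} · g(n)`,

i.e. over ONE octave the critical two-point function loses at most a factor `√n / c`, at every scale. For comparison: the
envelopes `c₀ n⁻² ≤ g(n) ≤ C n⁻¹` (Simon–Lieb / infrared bound) alone give the factor `(4C/c₀)·n`; the envelopes WITH reflection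
positivity already give `≍ √(n log n)` (the level bound below plus the lower envelope at `2n`: `c₀ ≤ 4n² g(2n) ≤ 16 C n ℓ 4^{-ℓ}`), which
is the quantitative content of the `log`-gradient estimate of Aizenman–Duminil-Copin (Prop. 5.9) along the axis; the Duminil-Copin–Panis
input removes the last `√(log n)`. So the theorem is a modest sharpening, recorded because it is the every-scale floor under item 6150
obtainable from the tree's present inputs, with the octave-loss machinery (loss ⇒ block halving ⇒ level and head-sum bounds) reusable
for any future Ising-specific input. Ingredients:

* REFLECTION POSITIVITY in the form of log-convexity of `g` along the axis (`criticalTwoPoint_axis_ratio_mono`): if an octave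
  loses `2^{-ℓ}` (`g(2n) ≤ 2^{-ℓ} g(n)`), the first ratio `r = g(n+1)/g(n)` has `rⁿ ≤ 2^{-ℓ}`, and every ratio below `n` is
  `≤ r`; so `g` decays at least geometrically, by a factor `2` per block of length `b = ⌊n/ℓ⌋ + 1`, all the way down from `n`
  (`Funnel.LogConvexSeq.block_halving`, file `…SqrtDoublingCore`). Consequences: the LEVEL is exponentially small,
  `n g(n) ≤ 4Cℓ 2^{-ℓ}` (`level_le_of_octave_loss_abstract`), and the HEAD SUM is small, `Σ_{k≤n} k g(k) ≤ 6Cb ≤ 12Cn/ℓ`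
  (`logConvex_head_sum`, file `…SqrtDoublingHeadSum`);
* the DUMINIL-COPIN–PANIS LOWER BOUND (CMP 2025, Thm 1.3, proved in the tree: `dcp_criticalTwoPoint_axis_lower_holds`) at scale
  `2n`: `g(2n) ≥ c₁ / (χ_{8n} + 2n Σ_{k≤4n} k g(k))`, whose denominator is bounded by the head sum and the level
  (`dcp_denominator_le`: sup-norm Messager–Miracle-Solé `box_sum_le_axis_sum` + monotonicity beyond `n`):
  `χ_{8n} + 2nΣ_{k≤4n} k g(k) ≤ 1 + 56 n Σ_{k≤n} k g(k) + 24216 n³ g(n)`.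
Bookkeeping (`octave_loss_arith`, `four_pow_le_of_octave_loss`): `c₁ ≤ C/n + 777600 C² n 4^{-ℓ}`, so for `n ≥ 2C/c₁` an
`ℓ`-octave loss forces `4^ℓ ≤ (1555200 C²/c₁) n`; with `ℓ = ⌊log₂(g(n)/g(2n))⌋` this is `g(2n)/g(n) > (2√(Kn))⁻¹`
(`octave_ratio_gt`; the side condition `4ℓ² ≤ n` comes from the envelope quotient `g(n)/g(2n) ≤ (4C/c₀) n` for `n ≥ 1536 C/c₀`).
Small `n` are absorbed into the constant by monotonicity (`sqrt_doubling`).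

Reading for item 6150 (honest): this does NOT prove doubling (`κ` independent of `n`); it caps the every-scale loss at `n^{1/2}`.
The exponent `1/2` appears to be the limit of the inputs used: a fat head plateau `g ≈ C/k` up to `k ≈ n/ℓ` followed by geometric
decay is compatible with log-convexity, the envelopes and the DCP inequality at the scales used here, and loses `≍ √n` (up to
logarithms) over the octave (cf. the completely monotone families of the crux NOTES, addendum c14). Removing the remaining `√n` needs
the Ising-specific two-scale input the crux chain has isolated (wall repulsion / overshoot forms of item 6150, line card).

References: H. Duminil-Copin, R. Panis, CMP 406 (2025) = arXiv:2404.05700, Theorem 1.3; M. Aizenman, H. Duminil-Copin, Ann. Math. 194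
(2021) = arXiv:1912.07973, Prop. 5.3, Prop. 5.9, Remark 5.10; A. Messager, S. Miracle-Solé, J. Stat. Phys. 17 (1977); B. Simon, CMP 77 (1980).
-/

noncomputable section

open Finset Real
open scoped BigOperators
open Literature.Probability.LatticeModels
open Summit.CriticalPhenomena.Ising3DConformalLimit.Theses

namespace Summit.CriticalPhenomena.Ising3DConformalLimit.Cruxes.ExistsScaleCovariantLimit


namespace FoldedCurrentRepulsion

/-- **The octave ratio at a large scale** (the contradiction step of `sqrt_doubling`, constants explicit). With the level
envelope `C`, the Simon–Lieb level `c₀ ≤ n² g(n)`, and the Duminil-Copin–Panis bound `c₁ ≤ g(2n)(1 + 56nΣ_{k≤n} k g(k) + 24216 n³ g(n))`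
(`2n ≥ N₁`): at every `n ≥ 1` with `2n ≥ N₁`, `n ≥ 2C/c₁`, `n ≥ 384·(4C/c₀)`, the octave ratio satisfies
`g(2n)/g(n) > 1/(2√(Kn))`, `K = 1555200 C²/c₁`. [cite: DuminilCopinPanis2025LowerBounds, Theorem 1.3] -/
theorem octave_ratio_gt {C c₀ c₁ : ℝ} {N₁ : ℕ} (hC : 0 < C) (hc₀ : 0 < c₀) (hc₁ : 0 < c₁)
    (henv : ∀ k : ℕ, 1 ≤ k → (k : ℝ) * criticalTwoPoint 3 (Pi.single 0 (k : ℤ)) ≤ C)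
    (hlow : ∀ k : ℕ, 1 ≤ k → c₀ ≤ (k : ℝ) ^ 2 * criticalTwoPoint 3 (Pi.single 0 (k : ℤ)))
    (hdcp : ∀ n : ℕ, 1 ≤ n → N₁ ≤ 2 * n →
      c₁ ≤ criticalTwoPoint 3 (Pi.single 0 ((2 * n : ℕ) : ℤ)) *
        (1 + 56 * n * (∑ k ∈ Icc 1 n, (k : ℝ) * criticalTwoPoint 3 (Pi.single 0 (k : ℤ))) +
          24216 * (n : ℝ) ^ 3 * criticalTwoPoint 3 (Pi.single 0 (n : ℤ))))
    {n : ℕ} (hn : 1 ≤ n) (hN1 : N₁ ≤ 2 * n) (hnC : 2 * C / c₁ ≤ n) (hnA : 384 * (4 * C / c₀) ≤ n)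
    (hhalf : criticalTwoPoint 3 (Pi.single 0 ((2 * n : ℕ) : ℤ)) ≤ 1 / 2 * criticalTwoPoint 3 (Pi.single 0 (n : ℤ))) :
    1 / (2 * Real.sqrt (1555200 * C ^ 2 / c₁ * n)) <
      criticalTwoPoint 3 (Pi.single 0 ((2 * n : ℕ) : ℤ)) / criticalTwoPoint 3 (Pi.single 0 (n : ℤ)) := by
  have hpos : ∀ m : ℕ, 0 < criticalTwoPoint 3 (Pi.single 0 (m : ℤ)) := Funnel.criticalTwoPoint_axis_pos 0
  have hmono := criticalTwoPoint_axis_ratio_mono 0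
  have hanti := Funnel.criticalTwoPoint_axis_antitone 0
  have hn0 : (0 : ℝ) < n := by exact_mod_cast hn
  have hg1 := hpos n
  have hg2 := hpos (2 * n)
  -- the octave ratio `κ ≤ 1/2`
  obtain ⟨κ, hκ⟩ : ∃ κ : ℝ, κ = criticalTwoPoint 3 (Pi.single 0 ((2 * n : ℕ) : ℤ)) /
      criticalTwoPoint 3 (Pi.single 0 (n : ℤ)) := ⟨_, rfl⟩
  rw [← hκ]
  have hκpos : 0 < κ := by rw [hκ]; exact div_pos hg2 hg1
  have hκhalf : κ ≤ 1 / 2 := by rw [hκ, div_le_iff₀ hg1]; exact hhalf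
  -- the trivial lower bound `1/κ ≤ (4C/c₀) n`
  have hκlow : 1 / κ ≤ 4 * C / c₀ * n := by
    have h2n := hlow (2 * n) (by omega)
    have e2 : (((2 * n : ℕ) : ℝ)) ^ 2 = 4 * (n : ℝ) ^ 2 := by push_cast; ring
    rw [e2] at h2n
    have hgn : (n : ℝ) * criticalTwoPoint 3 (Pi.single 0 (n : ℤ)) ≤ C := henv n hn
    have h1 : c₀ * ((n : ℝ) * criticalTwoPoint 3 (Pi.single 0 (n : ℤ))) ≤
        (4 * (n : ℝ) ^ 2 * criticalTwoPoint 3 (Pi.single 0 ((2 * n : ℕ) : ℤ))) * C := by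
      calc c₀ * ((n : ℝ) * criticalTwoPoint 3 (Pi.single 0 (n : ℤ)))
          ≤ (4 * (n : ℝ) ^ 2 * criticalTwoPoint 3 (Pi.single 0 ((2 * n : ℕ) : ℤ))) *
              ((n : ℝ) * criticalTwoPoint 3 (Pi.single 0 (n : ℤ))) :=
            mul_le_mul_of_nonneg_right h2n (mul_nonneg hn0.le hg1.le)
        _ ≤ (4 * (n : ℝ) ^ 2 * criticalTwoPoint 3 (Pi.single 0 ((2 * n : ℕ) : ℤ))) * C :=
            mul_le_mul_of_nonneg_left hgn (by positivity)
    rw [hκ, one_div_div, div_le_iff₀ hg2, div_mul_eq_mul_div, div_mul_eq_mul_div, le_div_iff₀ hc₀]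
    nlinarith [h1, hg1, hg2]
  -- `ℓ := ⌊log₂ ⌊1/κ⌋⌋ ≥ 1`, `2^ℓ ≤ 1/κ < 2^{ℓ+1}`
  obtain ⟨m, hm⟩ : ∃ m : ℕ, m = ⌊1 / κ⌋₊ := ⟨_, rfl⟩
  have hm2 : 2 ≤ m := by
    rw [hm]
    apply Nat.le_floor
    push_cast
    rw [le_one_div (by norm_num) hκpos]
    linarith
  obtain ⟨ℓ, hℓ⟩ : ∃ ℓ : ℕ, ℓ = Nat.log 2 m := ⟨_, rfl⟩
  have hℓ1 : 1 ≤ ℓ := by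
    rw [hℓ]
    exact Nat.le_log_of_pow_le (by norm_num) (by simpa using hm2)
  have h2ℓ : (2 : ℝ) ^ ℓ ≤ 1 / κ := by
    have h1 : 2 ^ ℓ ≤ m := hℓ ▸ Nat.pow_log_le_self 2 (by omega)
    have h2 : (m : ℝ) ≤ 1 / κ := hm ▸ Nat.floor_le (by positivity)
    calc (2 : ℝ) ^ ℓ = ((2 ^ ℓ : ℕ) : ℝ) := by push_cast; ring
      _ ≤ m := by exact_mod_cast h1
      _ ≤ 1 / κ := h2
  have hκ2 : 1 / κ < (2 : ℝ) ^ (ℓ + 1) := by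
    have h1 : m < 2 ^ (ℓ + 1) := hℓ ▸ Nat.lt_pow_succ_log_self (by norm_num) m
    have h2 : 1 / κ < m + 1 := hm ▸ Nat.lt_floor_add_one _
    have h3 : (m : ℝ) + 1 ≤ (2 : ℝ) ^ (ℓ + 1) := by exact_mod_cast h1
    linarith
  -- the octave loss `g(2n) ≤ 2^{-ℓ} g(n)`
  have hκle : κ ≤ (1 / 2 : ℝ) ^ ℓ := by
    rw [one_div_pow, le_one_div hκpos (by positivity)]
    simpa [one_div] using h2ℓ
  have hloss : criticalTwoPoint 3 (Pi.single 0 ((2 * n : ℕ) : ℤ)) ≤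
      (1 / 2 : ℝ) ^ ℓ * criticalTwoPoint 3 (Pi.single 0 (n : ℤ)) := by
    rw [hκ, div_le_iff₀ hg1] at hκle
    exact hκle
  -- `4 ℓ² ≤ n` from `2^ℓ ≤ A n`, `ℓ⁴ ≤ 24 · 2^ℓ`, `384 A ≤ n`
  have h4ℓ : 4 * ℓ ≤ n / ℓ := by
    rw [Nat.le_div_iff_mul_le (by omega)]
    have hℓ4 : (ℓ : ℝ) ^ 4 ≤ 24 * 2 ^ ℓ := Funnel.LogConvexSeq.pow_four_le_mul_two_pow ℓ
    have h2A : (2 : ℝ) ^ ℓ ≤ 4 * C / c₀ * n := h2ℓ.trans hκlow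
    have hApos : 0 < 4 * C / c₀ := by positivity
    have hsq : ((4 : ℝ) * ℓ ^ 2) ^ 2 ≤ (n : ℝ) ^ 2 := by
      calc ((4 : ℝ) * ℓ ^ 2) ^ 2 = 16 * (ℓ : ℝ) ^ 4 := by ring
        _ ≤ 16 * (24 * (4 * C / c₀ * n)) := by nlinarith [hℓ4, h2A]
        _ = (384 * (4 * C / c₀)) * n := by ring
        _ ≤ (n : ℝ) * n := mul_le_mul_of_nonneg_right hnA hn0.le
        _ = (n : ℝ) ^ 2 := by ring
    have h' : (4 : ℝ) * ℓ ^ 2 ≤ n :=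
      (pow_le_pow_iff_left₀ (by positivity : (0:ℝ) ≤ 4 * ℓ ^ 2) hn0.le two_ne_zero).1 hsq
    have : ((4 * ℓ * ℓ : ℕ) : ℝ) ≤ n := by push_cast; nlinarith [h']
    exact_mod_cast this
  -- the abstract octave-loss bound: `4^ℓ ≤ K n`
  have h4K : (4 : ℝ) ^ ℓ ≤ 1555200 * C ^ 2 / c₁ * n :=
    Funnel.LogConvexSeq.four_pow_le_of_octave_loss
      (G := fun m : ℕ => criticalTwoPoint 3 (Pi.single 0 (m : ℤ))) hpos hmono (fun k => hanti (Nat.le_succ k))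
      hC hc₁ henv (logConvex_descend _ hpos hmono)
      (fun b n' hb hh => logConvex_head_sum _ C b n' hpos hb henv hh)
      hn hnC hℓ1 h4ℓ hloss (hdcp n hn hN1)
  -- `1/κ < 2^{ℓ+1}`, `(2^{ℓ+1})² = 4·4^ℓ ≤ 4 K n`, so `κ > 1/(2 √(K n))`
  have hKn : 0 < 1555200 * C ^ 2 / c₁ * n := by positivity
  have hsq : (1 / κ) ^ 2 < (2 * Real.sqrt (1555200 * C ^ 2 / c₁ * n)) ^ 2 := by
    have e4 : ((2 : ℝ) ^ (ℓ + 1)) ^ 2 = 4 * (4 : ℝ) ^ ℓ := by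
      rw [show (4 : ℝ) = (2 : ℝ) ^ 2 by norm_num, ← pow_mul, ← pow_mul, ← pow_add]
      congr 1
      ring
    have e5 : (2 * Real.sqrt (1555200 * C ^ 2 / c₁ * n)) ^ 2 = 4 * (1555200 * C ^ 2 / c₁ * n) := by
      rw [mul_pow, Real.sq_sqrt hKn.le]; norm_num
    calc (1 / κ) ^ 2 < ((2 : ℝ) ^ (ℓ + 1)) ^ 2 := pow_lt_pow_left₀ hκ2 (by positivity) two_ne_zero
      _ = 4 * (4 : ℝ) ^ ℓ := e4
      _ ≤ 4 * (1555200 * C ^ 2 / c₁ * n) := by linarith [h4K]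
      _ = _ := e5.symm
  have hinv : 1 / κ < 2 * Real.sqrt (1555200 * C ^ 2 / c₁ * n) :=
    lt_of_pow_lt_pow_left₀ 2 (by positivity) hsq
  rw [one_div_lt (by positivity) hκpos]
  exact hinv

/-- **√n-DOUBLING AT EVERY SCALE** (registered sub-goal `sqrt_doubling`; F2 = item 6150 partial). There is `c > 0` with
`g(2n) ≥ c·n^{-1/2}·g(n)` for every `n ≥ 1`, `g(n) = ⟨σ₀σ_{ne₀}⟩_{β_c(3)}` — the loss of the critical axis two-point
function over one octave is at most a factor `√n/c` (the envelopes alone give a factor `∝ n`). Mechanism: if an octave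
loses `2^{-ℓ}`, reflection positivity (log-convexity) makes the whole range `[1, n]` decay at that rate, so the level `n g(n)`
is `≤ 4Cℓ2^{-ℓ}` and the head sum `Σ_{k≤n} k g(k)` is `≤ 12 C n/ℓ`; feeding these into Duminil-Copin–Panis' lower bound
`g(2n) ≥ c₁/(χ_{8n} + 2nΣ_{k≤4n} k g(k))` gives `4^ℓ ≤ K n`, i.e. `g(2n)/g(n) > 2^{-ℓ-1} ≥ (2√(Kn))⁻¹`.
[cite: DuminilCopinPanis2025LowerBounds, Theorem 1.3] [cite: AizenmanDuminilCopinAnnals2021, arXiv:1912.07973 Prop. 5.9 and Remark 5.10 (p. 20)] -/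
theorem sqrt_doubling : ∃ c : ℝ, 0 < c ∧ ∀ n : ℕ, 1 ≤ n → c * (n : ℝ) ^ (-(1 : ℝ) / 2) * criticalTwoPoint 3 (Pi.single 0 (n : ℤ)) ≤ criticalTwoPoint 3 (Pi.single 0 (2 * (n : ℤ))) := by
  have hpos : ∀ m : ℕ, 0 < criticalTwoPoint 3 (Pi.single 0 (m : ℤ)) := Funnel.criticalTwoPoint_axis_pos 0
  have hle1 : ∀ m : ℕ, criticalTwoPoint 3 (Pi.single 0 (m : ℤ)) ≤ 1 := fun m => criticalTwoPoint_le_one' _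
  have hanti := Funnel.criticalTwoPoint_axis_antitone 0
  obtain ⟨C, hC, henv⟩ := axis_level_le
  obtain ⟨c₀, hc₀, hlow⟩ := axis_sq_level_ge
  obtain ⟨c₁, hc₁, N₁, hdcp⟩ := dcp_head_level_bound
  -- constants
  obtain ⟨K, hK⟩ : ∃ K : ℝ, K = 1555200 * C ^ 2 / c₁ := ⟨_, rfl⟩
  have hKpos : 0 < K := by rw [hK]; positivity
  obtain ⟨N, hN⟩ : ∃ N : ℕ, N = max N₁ (max ⌈2 * C / c₁⌉₊ ⌈384 * (4 * C / c₀)⌉₊) + 1 := ⟨_, rfl⟩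
  obtain ⟨c, hc⟩ : ∃ c : ℝ, c = min (1 / 2) (min (1 / (2 * Real.sqrt K))
      (criticalTwoPoint 3 (Pi.single 0 ((2 * N : ℕ) : ℤ)))) := ⟨_, rfl⟩
  have hcpos : 0 < c := by rw [hc]; exact lt_min (by norm_num) (lt_min (by positivity) (hpos _))
  have hc_half : c ≤ 1 / 2 := by rw [hc]; exact min_le_left _ _
  have hc_K : c ≤ 1 / (2 * Real.sqrt K) := by rw [hc]; exact (min_le_right _ _).trans (min_le_left _ _)
  have hc_N : c ≤ criticalTwoPoint 3 (Pi.single 0 ((2 * N : ℕ) : ℤ)) := by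
    rw [hc]; exact (min_le_right _ _).trans (min_le_right _ _)
  refine ⟨c, hcpos, fun n hn => ?_⟩
  rw [Funnel.criticalTwoPoint_two_mul]
  have hn0 : (0 : ℝ) < n := by exact_mod_cast hn
  have hrpow : (n : ℝ) ^ (-(1 : ℝ) / 2) = (Real.sqrt n)⁻¹ := by
    rw [show (-(1 : ℝ) / 2) = -((1 : ℝ) / 2) by ring, Real.rpow_neg hn0.le, ← Real.sqrt_eq_rpow]
  have hsqrt1 : 1 ≤ Real.sqrt n := by
    rw [← Real.sqrt_one]; exact Real.sqrt_le_sqrt (by exact_mod_cast hn)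
  have hrpow_le : (n : ℝ) ^ (-(1 : ℝ) / 2) ≤ 1 := by
    rw [hrpow]; exact inv_le_one_of_one_le₀ hsqrt1
  have hrpow_pos : 0 < (n : ℝ) ^ (-(1 : ℝ) / 2) := by rw [hrpow]; positivity
  rcases lt_or_ge n N with hnN | hnN
  · -- small scales: `c n^{-1/2} g(n) ≤ g(2N) ≤ g(2n)`
    calc c * (n : ℝ) ^ (-(1 : ℝ) / 2) * criticalTwoPoint 3 (Pi.single 0 (n : ℤ))
        ≤ criticalTwoPoint 3 (Pi.single 0 ((2 * N : ℕ) : ℤ)) * 1 * 1 :=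
          mul_le_mul (mul_le_mul hc_N hrpow_le hrpow_pos.le (hpos _).le) (hle1 n) (hpos n).le
            (mul_nonneg (hpos _).le zero_le_one)
      _ = criticalTwoPoint 3 (Pi.single 0 ((2 * N : ℕ) : ℤ)) := by ring
      _ ≤ criticalTwoPoint 3 (Pi.single 0 ((2 * n : ℕ) : ℤ)) := hanti (by omega)
  · -- large scales
    have hN1 : N₁ ≤ 2 * n := by omega
    have hmax : max ⌈2 * C / c₁⌉₊ ⌈384 * (4 * C / c₀)⌉₊ < n := by omega
    have hnC : 2 * C / c₁ ≤ n := by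
      have h := (Nat.ceil_le.1 (le_of_lt (lt_of_le_of_lt (le_max_left _ _) hmax)))
      exact_mod_cast h
    have hnA : 384 * (4 * C / c₀) ≤ n := by
      have h := (Nat.ceil_le.1 (le_of_lt (lt_of_le_of_lt (le_max_right _ _) hmax)))
      exact_mod_cast h
    by_cases hhalf : criticalTwoPoint 3 (Pi.single 0 ((2 * n : ℕ) : ℤ)) ≤
        1 / 2 * criticalTwoPoint 3 (Pi.single 0 (n : ℤ))
    · -- deep loss impossible beyond `√n`: `g(2n)/g(n) > 1/(2√(Kn)) ≥ c n^{-1/2}`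
      have hgt := octave_ratio_gt hC hc₀ hc₁ henv hlow hdcp hn hN1 hnC hnA hhalf
      rw [← hK] at hgt
      have hKn : 0 < K * n := by positivity
      have hcle : c * (n : ℝ) ^ (-(1 : ℝ) / 2) ≤ 1 / (2 * Real.sqrt (K * n)) := by
        rw [hrpow, Real.sqrt_mul hKpos.le, show 1 / (2 * (Real.sqrt K * Real.sqrt n)) =
          1 / (2 * Real.sqrt K) * (Real.sqrt n)⁻¹ by field_simp]
        exact mul_le_mul_of_nonneg_right hc_K (by positivity)
      have h := (lt_div_iff₀ (hpos n)).1 (hcle.trans_lt hgt)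
      exact h.le
    · -- no loss beyond `1/2`: `c n^{-1/2} g(n) ≤ (1/2) g(n) < g(2n)`
      push Not at hhalf
      have : c * (n : ℝ) ^ (-(1 : ℝ) / 2) ≤ 1 / 2 * 1 := mul_le_mul hc_half hrpow_le hrpow_pos.le (by norm_num)
      nlinarith [hpos n, hhalf]

/-- **Corollary — the axial gradient bound with leading constant `1`.** There is `A` with
`k·(1 − g(k+1)/g(k)) ≤ log k + A` for every `k ≥ 1`, i.e. `g(k) − g(k+1) ≤ (log k + A)·g(k)/k`: the `log`-gradient estimate of
Aizenman–Duminil-Copin (Prop. 5.9) along the axis of `ℤ³` with the constant in front of `log k` equal to `1` (item 6150 = removing the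
`log`). From `sqrt_doubling` and log-convexity: with `n = ⌊(k+1)/2⌋`, `r_kⁿ ≥ Π_{j=n}^{2n−1} r_j = g(2n)/g(n) ≥ c n^{-1/2}`.
[cite: AizenmanDuminilCopinAnnals2021, arXiv:1912.07973 Prop. 5.9 and Remark 5.10 (p. 20)] -/
theorem axis_ratio_rate_log : ∃ A : ℝ, ∀ k : ℕ, 1 ≤ k →
    (k : ℝ) * (1 - criticalTwoPoint 3 (Pi.single 0 ((k + 1 : ℕ) : ℤ)) / criticalTwoPoint 3 (Pi.single 0 (k : ℤ))) ≤
      Real.log k + A := by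
  have hpos : ∀ m : ℕ, 0 < criticalTwoPoint 3 (Pi.single 0 (m : ℤ)) := Funnel.criticalTwoPoint_axis_pos 0
  have hmono := criticalTwoPoint_axis_ratio_mono 0
  obtain ⟨c, hc, hsq⟩ := sqrt_doubling
  refine ⟨-2 * Real.log c, fun k hk => ?_⟩
  -- `n = ⌊(k+1)/2⌋`: `1 ≤ n`, `2n - 1 ≤ k ≤ 2n`
  obtain ⟨n, hn⟩ : ∃ n : ℕ, n = (k + 1) / 2 := ⟨_, rfl⟩
  have hn1 : 1 ≤ n := by omega
  have hkn : k ≤ 2 * n := by omega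
  have hnk : 2 * n ≤ k + 1 := by omega
  set r : ℝ := criticalTwoPoint 3 (Pi.single 0 ((k + 1 : ℕ) : ℤ)) / criticalTwoPoint 3 (Pi.single 0 (k : ℤ)) with hr
  have hrpos : 0 < r := div_pos (hpos _) (hpos _)
  have hr1 : r ≤ 1 := by
    rw [hr, div_le_one (hpos k)]
    exact Funnel.criticalTwoPoint_axis_antitone 0 (Nat.le_succ k)
  -- `g(2n) ≤ rⁿ g(n)`: the `n` ratios at `n, …, 2n-1 ≤ k` are each `≤ r`
  have hup : criticalTwoPoint 3 (Pi.single 0 ((n + n : ℕ) : ℤ)) ≤ r ^ n * criticalTwoPoint 3 (Pi.single 0 (n : ℤ)) := by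
    have h := Funnel.LogConvexSeq.add_le_pow_mul (G := fun m : ℕ => criticalTwoPoint 3 (Pi.single 0 (m : ℤ))) hpos hmono
      (n := n) (k := k - 1) (by omega) n le_rfl
    rw [show k - 1 + 2 = k + 1 by omega, show k - 1 + 1 = k by omega] at h
    exact h
  -- `c n^{-1/2} g(n) ≤ g(2n)`
  have hlow := hsq n hn1
  rw [Funnel.criticalTwoPoint_two_mul, show 2 * n = n + n by ring] at hlow
  have hn0 : (0 : ℝ) < n := by exact_mod_cast hn1
  have hgn := hpos n
  -- hence `c n^{-1/2} ≤ rⁿ`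
  have hcr : c * (n : ℝ) ^ (-(1 : ℝ) / 2) ≤ r ^ n := le_of_mul_le_mul_right (hlow.trans hup) hgn
  -- logs: `log c - (1/2) log n ≤ n log r`, and `1 - r ≤ -log r`
  have hlog : Real.log c + (-(1 : ℝ) / 2) * Real.log n ≤ n * Real.log r := by
    have h1 : Real.log (c * (n : ℝ) ^ (-(1 : ℝ) / 2)) ≤ Real.log (r ^ n) :=
      Real.log_le_log (by positivity) hcr
    rw [Real.log_mul hc.ne' (by positivity), Real.log_rpow hn0, Real.log_pow] at h1
    linarith
  have h1r : 1 - r ≤ -Real.log r := by linarith [Real.log_le_sub_one_of_pos hrpos]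
  have hlogn : Real.log n ≤ Real.log k :=
    Real.log_le_log hn0 (by exact_mod_cast (show n ≤ k by omega))
  have hk2n : (k : ℝ) ≤ 2 * n := by exact_mod_cast hkn
  have h1r0 : 0 ≤ 1 - r := by linarith
  calc (k : ℝ) * (1 - r) ≤ (2 * n) * (1 - r) := mul_le_mul_of_nonneg_right hk2n h1r0
    _ ≤ (2 * n) * (-Real.log r) := mul_le_mul_of_nonneg_left h1r (by positivity)
    _ = -2 * (n * Real.log r) := by ring
    _ ≤ -2 * (Real.log c + (-(1 : ℝ) / 2) * Real.log n) := by linarith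
    _ = Real.log n + -2 * Real.log c := by ring
    _ ≤ Real.log k + -2 * Real.log c := by linarith

end FoldedCurrentRepulsion

end Summit.CriticalPhenomena.Ising3DConformalLimit.Cruxes.ExistsScaleCovariantLimit

end
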